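import Summits.AnomalousDissipation.AnomalousDissipation.Theses.TameRoughRigidity
import Summits.AnomalousDissipation.AnomalousDissipation.Theorems.GPStatisticalRigidity.Negative.LoadBearing
import Summits.AnomalousDissipation.AnomalousDissipation.Theorems.EnsembleRigidityGPStatisticalRigidityDesaturation
import Literature.Analysis.FluidPDE.CylindricalGenerator
import Literature.Analysis.FluidPDE.StatisticalSolutionProofs
import HarnessLib

/-!
# Stub `stub_evenSymmetrise` of line `Sketch` (crux stmt-AnomalousDissipation-18401,
  `TameRoughRigidity.TameToRough`)

**S0 — time-reversal symmetrisation.** For a force `f ∈ L²(T³)` and a Borel probability measure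
`μ` on the energy space `H = L²_σ(T³)` with integrable energy and cylindrical forced-Euler defect
constant `R ≥ 0`, the symmetrised measure `μ' := ½ (μ + T_* μ)`, `T v = −v`, is an EVEN
probability measure (`T_* μ' = μ'`) with integrable energy, the SAME mean energy and mean
enstrophy, ZERO (hence non-negative) work on every energy shell, and the same defect constant `R`.

Proof. `T` is an isometric measurable involution of `H` (`MeasurableEquiv.neg`), so
`T_*(½(μ + T_*μ)) = ½(T_*μ + μ)`. Energy, integrability and enstrophy are `T`-invariant
(`‖−v‖ = ‖v‖`, `‖∇(−v)‖² = ‖∇v‖²` through the a.e. class, `desaturation_eGradNormSq_neg`); the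
work `(v, f)` is odd and every shell `{e₁ ≤ |v|² < e₂}` is even, so `μ'` has zero shell work.
For the defect: every cylindrical `Φ` has a reflected cylindrical `TΦ` with `(TΦ)'(v) = −Φ'(−v)`
(`desaturation_exists_reflect`), `⟨F₀(−v), w⟩ = ⟨F₀(v), w⟩` (the inertial term is quadratic,
`desaturation_generator_neg_left`), `⟨F₀(v), −w⟩ = −⟨F₀(v), w⟩`
(`desaturation_generator_neg_right`) and `‖∇(−w)‖² = ‖∇w‖²` (`desaturation_gradNormSq_neg`);
hence `∫ ⟨F₀, Φ'⟩ dT_*μ = −∫ ⟨F₀, (TΦ)'⟩ dμ`, `∫ ‖∇Φ'‖² dT_*μ = ∫ ‖∇(TΦ)'‖² dμ`, and the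
power-mean inequality `(x + y)/2 ≤ √((x² + y²)/2)` (`desaturation_powerMean`) gives the defect
bound for `μ'` at the same `R`. The pattern is the landed `stub_desaturation`
(`Theorems/EnsembleRigidityGPStatisticalRigidityDesaturation.lean`).

## References

* C. Foias, O. Manley, R. Rosa, R. Temam, *Navier–Stokes Equations and Turbulence* (CUP 2001),
  Ch. IV §1.2 Def. 1.3, (1.29)–(1.31). [FoiasManleyRosaTemam2001]
-/

set_option linter.dupNamespace false

noncomputable section

namespace Summit.AnomalousDissipation.AnomalousDissipation.Theorems.TameRoughRigidity.TameToRough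

open MeasureTheory Filter Topology UnitAddTorus
open scoped InnerProductSpace RealInnerProductSpace ENNReal NNReal
open Literature.Analysis.FunctionSpaces Literature.Analysis.FluidPDE
open Summit.AnomalousDissipation.AnomalousDissipation.Theses.TameRoughRigidity
open Summit.AnomalousDissipation.AnomalousDissipation.Theorems.GPStatisticalRigidity.Negative

/-- Local notation: real vector fields on `T³`. -/
local notation "Vec3" => (UnitAddTorus (Fin 3)) → (EuclideanSpace ℝ (Fin 3))
/-- Local notation: `L²(T³; ℝ³)`. -/
local notation "L2" => (Lp (EuclideanSpace ℝ (Fin 3)) 2 (volume : Measure (UnitAddTorus (Fin 3))))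
/-- Local notation: the energy space `H`. -/
local notation "H3" => (Torus.energySpace (Fin 3))

/-! ### Negation on `H`: the work functional is odd -/

/-- The work functional is odd: `(−v, g) = −(v, g)` for `g ∈ L²` (re-proved here; the copy in
the pattern file `EnsembleRigidityGPStatisticalRigidityDesaturation` is private). [folklore] -/
private theorem evenSymmetrise_pairing_neg {g : Vec3} (hg : MemLp g 2 volume) (v : H3) :
    Torus.pairing (((-v : H3) : L2)) g = -Torus.pairing ((v : H3) : L2) g := by
  -- adapted from `GPStatisticalRigidity.desaturation_pairing_neg`
  rw [Submodule.coe_neg, Torus.pairing_eq_inner hg, Torus.pairing_eq_inner hg, inner_neg_left]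

/-! ### The stub -/

/-- **S0 `stub_evenSymmetrise`.** For `f ∈ L²` and a probability measure `μ` on `H` with
integrable energy and defect constant `R ≥ 0`, the symmetrised measure `μ' = ½(μ + T_*μ)`,
`T v = −v`, is an EVEN probability measure (`T_*μ' = μ'`) with the same mean energy and mean
enstrophy, integrable energy, ZERO (hence non-negative) work on every energy shell and the same
defect constant `R` (power mean `(√a+√b)/2 ≤ √((a+b)/2)` on the test enstrophies;
`(TΦ)'(v) = −Φ'(−v)`, `⟨F₀(−v), w⟩ = ⟨F₀(v), w⟩`, `⟨F₀(v), −w⟩ = −⟨F₀(v), w⟩`). [folklore] -/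
theorem stub_evenSymmetrise (f : Vec3) (hf : MemLp f 2 volume) (μ : Measure H3)
    (hprob : IsProbabilityMeasure μ) (hint : Integrable (fun v : H3 => ‖v‖ ^ 2) μ)
    (R : ℝ) (hR : 0 ≤ R) (hdef : DefectLE f μ R) :
    ∃ μ' : Measure H3, IsProbabilityMeasure μ' ∧ Integrable (fun v : H3 => ‖v‖ ^ 2) μ' ∧
      Torus.ensembleEnergy μ' = Torus.ensembleEnergy μ ∧
      Torus.ensembleEnstrophy μ' = Torus.ensembleEnstrophy μ ∧
      μ'.map (fun v : H3 => -v) = μ' ∧ ShellWorkNonneg f μ' ∧ DefectLE f μ' R := by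
  -- adapted from `stub_desaturation` (`EnsembleRigidityGPStatisticalRigidityDesaturation`)
  haveI := hprob
  -- the reflection `T` and the push-forward `ν = T_* μ`
  have hTa : ∀ v : H3, MeasurableEquiv.neg H3 v = -v := fun v => by simp
  have hfun : (fun v : H3 => -v) = ⇑(MeasurableEquiv.neg H3) := funext fun v => (hTa v).symm
  set ν : Measure H3 := μ.map (MeasurableEquiv.neg H3) with hν
  haveI : IsProbabilityMeasure ν :=
    Measure.isProbabilityMeasure_map (MeasurableEquiv.neg H3).measurable.aemeasurable
  have hIν : ∀ g : H3 → ℝ, ∫ v, g v ∂ν = ∫ v, g (-v) ∂μ := fun g => by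
    rw [hν, integral_map_equiv]
    simp only [hTa]
  have hIntν : ∀ g : H3 → ℝ, Integrable (fun v => g (-v)) μ → Integrable g ν := fun g hg => by
    rw [hν]
    refine (integrable_map_equiv _ g).2 ?_
    simpa only [Function.comp_def, hTa] using hg
  -- `T` is an involution: `T_* ν = μ`
  have hback : ν.map (MeasurableEquiv.neg H3) = μ := by
    have h := MeasurableEquiv.map_symm_map (μ := μ) (MeasurableEquiv.neg H3)
    rw [MeasurableEquiv.symm_neg] at h
    rw [hν]
    exact h
  -- the symmetrised measure `μ' = ½ (μ + ν)`
  set μ' : Measure H3 := (2⁻¹ : ℝ≥0∞) • (μ + ν) with hμ'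
  have h2 : (2⁻¹ : ℝ≥0∞) * 2 = 1 := ENNReal.inv_mul_cancel two_ne_zero ENNReal.ofNat_ne_top
  have hprob' : IsProbabilityMeasure μ' := ⟨by
    rw [hμ', Measure.smul_apply, Measure.add_apply, measure_univ, measure_univ, smul_eq_mul,
      one_add_one_eq_two, h2]⟩
  have hInt' : ∀ g : H3 → ℝ, Integrable g μ → Integrable g ν → Integrable g μ' :=
    fun g h1 h2 => by
    rw [hμ']
    exact (h1.add_measure h2).smul_measure (ENNReal.inv_ne_top.2 two_ne_zero)
  have hI : ∀ g : H3 → ℝ, Integrable g μ → Integrable g ν →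
      ∫ v, g v ∂μ' = 2⁻¹ * ((∫ v, g v ∂μ) + ∫ v, g (-v) ∂μ) := fun g hgμ hgν => by
    rw [hμ', integral_smul_measure, integral_add_measure hgμ hgν, hIν, smul_eq_mul,
      ENNReal.toReal_inv, ENNReal.toReal_ofNat]
  -- evenness: `T_* μ' = ½ (T_* μ + T_* ν) = ½ (ν + μ) = μ'`
  have heven : μ'.map (fun v : H3 => -v) = μ' := by
    rw [hfun, hμ', Measure.map_smul, Measure.map_add _ _ (MeasurableEquiv.neg H3).measurable,
      hback, ← hν, add_comm ν μ]
  -- energy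
  have hintν : Integrable (fun v : H3 => ‖v‖ ^ 2) ν :=
    hIntν _ (by simpa only [norm_neg] using hint)
  have hint' : Integrable (fun v : H3 => ‖v‖ ^ 2) μ' := hInt' _ hint hintν
  have hEeq : Torus.ensembleEnergy μ' = Torus.ensembleEnergy μ := by
    unfold Torus.ensembleEnergy
    rw [hI _ hint hintν]
    simp only [norm_neg]
    ring
  -- enstrophy
  have hGeq : Torus.ensembleEnstrophy μ' = Torus.ensembleEnstrophy μ := by
    unfold Torus.ensembleEnstrophy
    rw [hμ', lintegral_smul_measure, lintegral_add_measure, hν, lintegral_map_equiv]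
    simp only [hTa, EnsembleRigidity.GPStatisticalRigidity.desaturation_eGradNormSq_neg,
      smul_eq_mul]
    rw [← two_mul, ← mul_assoc, h2, one_mul]
  -- zero shell work
  have hP : Integrable (fun v : H3 => Torus.pairing (v : L2) f) μ := by
    refine Integrable.mono' ((hint.add (integrable_const 1)).const_mul ‖hf.toLp f‖)
      (Torus.continuous_pairing_coe hf).aestronglyMeasurable (ae_of_all _ fun v => ?_)
    rw [Real.norm_eq_abs]
    refine (Torus.abs_pairing_coe_le hf v).trans ?_
    simp only [Pi.add_apply]
    nlinarith [mul_nonneg (norm_nonneg (hf.toLp f)) (sq_nonneg (‖v‖ - 1)),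
      mul_nonneg (norm_nonneg (hf.toLp f)) (norm_nonneg v)]
  have hPν : Integrable (fun v : H3 => Torus.pairing (v : L2) f) ν :=
    hIntν _ (by simpa only [evenSymmetrise_pairing_neg hf] using hP.fun_neg)
  have hshell : ShellWorkNonneg f μ' := by
    intro e₁ e₂ _
    have hpre : (MeasurableEquiv.neg H3) ⁻¹' {v : H3 | e₁ ≤ ‖v‖ₑ ^ 2 ∧ ‖v‖ₑ ^ 2 < e₂} =
        {v : H3 | e₁ ≤ ‖v‖ₑ ^ 2 ∧ ‖v‖ₑ ^ 2 < e₂} := by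
      ext v
      simp only [Set.mem_preimage, Set.mem_setOf_eq, hTa, enorm_neg]
    rw [hμ', Measure.restrict_smul, Measure.restrict_add, integral_smul_measure,
      integral_add_measure hP.restrict hPν.restrict, hν, setIntegral_map_equiv, hpre]
    simp only [hTa, evenSymmetrise_pairing_neg hf, integral_neg, add_neg_cancel, smul_zero,
      le_refl]
  -- the defect clause at the same `R`
  have hdef' : DefectLE f μ' R := by
    intro Φ
    obtain ⟨Ψ, hΨ⟩ := EnsembleRigidity.GPStatisticalRigidity.desaturation_exists_reflect Φ
    have hgen : ∀ v : H3, Torus.nsGeneratorPairing 0 f (-v) (Φ.grad (-v)) =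
        -Torus.nsGeneratorPairing 0 f v (Ψ.grad v) := fun v => by
      rw [hΨ, EnsembleRigidity.GPStatisticalRigidity.desaturation_generator_neg_right, neg_neg,
        EnsembleRigidity.GPStatisticalRigidity.desaturation_generator_neg_left]
    have hens : ∀ v : H3, Torus.gradNormSq (Φ.grad (-v)) = Torus.gradNormSq (Ψ.grad v) :=
      fun v => by
      rw [hΨ, EnsembleRigidity.GPStatisticalRigidity.desaturation_gradNormSq_neg]
    obtain ⟨hLμ, hbd⟩ := hdef Φ
    obtain ⟨hLΨ, hbdΨ⟩ := hdef Ψ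
    have hLν : Integrable (fun v : H3 => Torus.nsGeneratorPairing 0 f v (Φ.grad v)) ν := by
      refine hIntν _ ?_
      simp_rw [hgen]
      exact hLΨ.fun_neg
    have hNμ := EnsembleRigidity.GPStatisticalRigidity.desaturation_integrable_testEnstrophy Φ μ
    have hNν : Integrable (fun v : H3 => Torus.gradNormSq (Φ.grad v)) ν := by
      refine hIntν _ ?_
      simp_rw [hens]
      exact EnsembleRigidity.GPStatisticalRigidity.desaturation_integrable_testEnstrophy Ψ μ
    refine ⟨hInt' _ hLμ hLν, ?_⟩
    rw [hI _ hLμ hLν, hI _ hNμ hNν]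
    simp_rw [hgen, hens, integral_neg]
    exact EnsembleRigidity.GPStatisticalRigidity.desaturation_powerMean hR
      (integral_nonneg fun v => Torus.gradNormSq_nonneg _)
      (integral_nonneg fun v => Torus.gradNormSq_nonneg _) hbd hbdΨ
  exact ⟨μ', hprob', hint', hEeq, hGeq, heven, hshell, hdef'⟩

end Summit.AnomalousDissipation.AnomalousDissipation.Theorems.TameRoughRigidity.TameToRough

end
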